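import Literature.MathematicalPhysics.QuantumFieldTheory.WilsonEnergyStrictMonotone
import Literature.MathematicalPhysics.QuantumFieldTheory.WilsonPlaquetteWeakCouplingFloor
import HarnessLib

/-!
# The plaquette expectation of Wilson's lattice gauge theory is non-zero at every `β ≠ 0`

Finite torus `(ℤ/Lℤ)^d`, `L ≥ 2`, compact gauge group `G`, continuous `N`-dimensional
representation `ρ` (`N ≥ 1`) possessing a central element `z` that acts by a scalar `ω ≠ 1`,
`|ω| = 1` (the centre of `SU(N)` in the fundamental representation; `ω = -1` for `SU(2)`).  Then for
every site `x`, axes `i ≠ j`: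

* `wilsonExpectation_re_trace_plaquette_pos` / `_neg` — `⟨Re tr ρ(U_{x,ij})⟩_{Λ,β} > 0` for `β > 0`
  and `< 0` for `β < 0`; `wilsonExpectation_wilsonLoop_one_one_pos` / `_neg` — the same for the
  normalised `1 × 1` Wilson loop `wilsonLoop ρ x i j 1 1`.

Ingredients: (i) `integral_trace_plaquetteHolonomy_eq_zero` — the Haar mean of the plaquette
character vanishes (the substitution `U_{x,i} ↦ z U_{x,i}` preserves product Haar measure and
multiplies the character by `ω`), hence `⟨S⟩_{Λ,0} = N · #plaquettes`
(`wilsonExpectation_wilsonAction_zero`); (ii) the STRICT decrease of the mean action in `β`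
(`WilsonEnergyStrictMonotone`; the action is not identically zero: one link equal to `z` costs
`N(1 - Re ω) > 0`); (iii) all plaquettes have the same mean (tree:
`wilsonExpectation_wilsonAction_eq_card_mul`, translations and axis permutations).

The internal energy / mean plaquette is Montvay–Münster's `E` of (3.113); that `E(β)` is strictly
monotone on a finite periodic lattice and that the plaquette is positive for `β > 0` is folklore for
which we know no printed proof in this generality (for non-abelian `G` Griffiths' inequalities are
not available); everything here is proved from the tree.  NOT here: bounds uniform in the volume
(see `WilsonPlaquetteWeakCouplingFloor` for `β` large and `PlaquetteLowerBound` for `β` small).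

## References

* I. Montvay, G. Münster, *Quantum Fields on a Lattice*, CUP 1994, §3.2 (3.113), PDF p. 123
  (internal energy = mean plaquette; translation invariance on the periodic lattice).
  [MontvayMunster1994]
* S. Friedli, Y. Velenik, *Statistical Mechanics of Lattice Systems*, CUP 2017, Lemma 3.5.
  [FriedliVelenik2017]
-/

noncomputable section

open MeasureTheory
open Literature.RepresentationTheory.CompactGroups

namespace Literature.MathematicalPhysics.QuantumFieldTheory

variable {d L N : ℕ} {G : Type*} [Group G] [TopologicalSpace G] [IsTopologicalGroup G]
  [CompactSpace G] [MeasurableSpace G] [BorelSpace G] (ρ : G →* Matrix (Fin N) (Fin N) ℂ)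

/-! ### The Haar mean of a plaquette character vanishes; `⟨S⟩_0 = N · #plaquettes` -/

section HaarMean

variable [NeZero L]

/-- Left multiplication of ONE link variable by a fixed group element preserves the product Haar
measure (left invariance of Haar measure on the compact group, factorwise). [folklore] -/
private theorem measurePreserving_mulLink (e₀ : Edge d L) (z : G) :
    MeasurePreserving (fun (U : GaugeConfig d L G) (e : Edge d L) => (if e = e₀ then z else 1) * U e)
      (Measure.pi fun _ : Edge d L => haarProbability G)
      (Measure.pi fun _ : Edge d L => haarProbability G) :=
  measurePreserving_pi _ _ fun e => measurePreserving_mul_left (haarProbability G) (if e = e₀ then z else 1)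

omit [TopologicalSpace G] [IsTopologicalGroup G] [CompactSpace G] [MeasurableSpace G] [BorelSpace G]
  [NeZero L] in
/-- Multiplying the link `(x, i)` by `z` multiplies the holonomy of the plaquette `(x; i, j)`, `i ≠ j`,
by `z` on the left (torus of side `≥ 2`, so that the four links of the plaquette are distinct).
[folklore] -/
private theorem plaquetteHolonomy_mulLink [Fact (1 < L)] (z : G) (x : Site d L) {i j : Fin d}
    (hij : i ≠ j) (U : GaugeConfig d L G) :
    plaquetteHolonomy (fun e : Edge d L => (if e = (x, i) then z else 1) * U e) x i j =
      z * plaquetteHolonomy U x i j := by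
  have hne1 : (x.shift i, j) ≠ (x, i) := fun h => hij (congrArg Prod.snd h).symm
  have hne2 : (x.shift j, i) ≠ (x, i) := by
    intro h
    have h1 : (x.shift j) j = x j := congrFun (congrArg Prod.fst h) j
    rw [WilsonRP.shift_apply_self] at h1
    have h2 : (1 : ZMod L) = 0 :=
      calc (1 : ZMod L) = x j + 1 - x j := by ring
        _ = x j - x j := by rw [h1]
        _ = 0 := sub_self _
    exact one_ne_zero h2
  have hne3 : (x, j) ≠ (x, i) := fun h => hij (congrArg Prod.snd h).symm
  simp only [plaquetteHolonomy, if_true, if_neg hne1, if_neg hne2, if_neg hne3, one_mul, mul_assoc]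

omit [CompactSpace G] [NeZero L] in
/-- The complex character `U ↦ tr ρ(U_{x,ij})` of a plaquette is measurable for the product
σ-algebra (continuous `ρ`; no countability assumption on `G`). [folklore] -/
private theorem measurable_trace_plaquetteHolonomy (hρ : Continuous ρ) (x : Site d L) (i j : Fin d) :
    Measurable fun U : GaugeConfig d L G => (ρ (plaquetteHolonomy U x i j)).trace := by
  have hE : WilsonRP.EntryMeasurable ρ (fun U : GaugeConfig d L G => plaquetteHolonomy U x i j) := by
    unfold plaquetteHolonomy
    exact (((WilsonRP.entryMeasurable_apply hρ _).mul (WilsonRP.entryMeasurable_apply hρ _)).mul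
      (WilsonRP.entryMeasurable_apply_inv hρ _)).mul (WilsonRP.entryMeasurable_apply_inv hρ _)
  simp only [Matrix.trace, Matrix.diag_apply]
  exact Finset.measurable_sum _ fun k _ => hE k k

omit [MeasurableSpace G] [BorelSpace G] in
/-- `‖tr ρ(g)‖ ≤ N` for a continuous `N`-dimensional representation of a compact group (unitarisable,
entries of modulus `≤ 1`). [folklore] -/
private theorem norm_trace_le (hρ : Continuous ρ) (g : G) : ‖(ρ g).trace‖ ≤ N := by
  rw [← CompactGroup.trace_unitarize ρ hρ g, Matrix.trace]
  calc ‖∑ k, Matrix.diag (CompactGroup.unitarize ρ hρ g) k‖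
      ≤ ∑ k, ‖Matrix.diag (CompactGroup.unitarize ρ hρ g) k‖ := norm_sum_le _ _
    _ ≤ ∑ _k : Fin N, (1 : ℝ) := Finset.sum_le_sum fun k _ => by
        rw [Matrix.diag_apply]; exact CompactGroup.norm_unitarize_apply_le_one ρ hρ g k k
    _ = N := by simp

omit [NeZero L] in
/-- The real character of a plaquette is integrable for every finite measure. [folklore] -/
private theorem integrable_re_trace_plaquetteHolonomy (hρ : Continuous ρ) (x : Site d L) (i j : Fin d)
    (μ : Measure (GaugeConfig d L G)) [IsFiniteMeasure μ] :
    Integrable (fun U : GaugeConfig d L G => (ρ (plaquetteHolonomy U x i j)).trace.re) μ := by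
  refine Integrable.of_bound (C := (N : ℝ))
    (Complex.measurable_re.comp (measurable_trace_plaquetteHolonomy ρ hρ x i j)).aestronglyMeasurable
    (ae_of_all _ fun U => ?_)
  rw [Real.norm_eq_abs]
  simpa using CompactGroup.abs_re_trace_le_card ρ hρ (plaquetteHolonomy U x i j)

/-- **The Haar mean of a plaquette character vanishes** when some central `z ∈ G` acts in `ρ` by a
scalar `ω ≠ 1` (e.g. the centre of `SU(N)` in the fundamental representation): on the torus of side
`L ≥ 2`, `∫ tr ρ(U_{x,ij}) ∏ₑ dU_e = 0` for `i ≠ j`.  Proof: the substitution `U_{x,i} ↦ z U_{x,i}`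
preserves product Haar measure and multiplies the integral by `ω` — the torus form of the character
orthogonality `∫ dU χ_r(U) = δ_{r,0}` (Montvay–Münster (3.305); `ρ` need not be irreducible, it only has
no trivial component on which `z` could act by `1`). [cite: MontvayMunster1994, §3.4 eq. (3.305), PDF p. 142] -/
theorem integral_trace_plaquetteHolonomy_eq_zero [Fact (1 < L)] (hρ : Continuous ρ) {z : G} {ω : ℂ}
    (hω : ρ z = ω • (1 : Matrix (Fin N) (Fin N) ℂ)) (hne : ω ≠ 1) (x : Site d L) {i j : Fin d}
    (hij : i ≠ j) :
    ∫ U, (ρ (plaquetteHolonomy U x i j)).trace ∂(Measure.pi fun _ : Edge d L => haarProbability G) = 0 := by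
  set π : Measure (GaugeConfig d L G) := Measure.pi fun _ : Edge d L => haarProbability G with hπ
  set Φ : GaugeConfig d L G → GaugeConfig d L G :=
    fun U e => (if e = (x, i) then z else 1) * U e with hΦ
  have hΦm : MeasurePreserving Φ π π := measurePreserving_mulLink (x, i) z
  set f : GaugeConfig d L G → ℂ := fun U => (ρ (plaquetteHolonomy U x i j)).trace with hf
  have hfm : Measurable f := measurable_trace_plaquetteHolonomy ρ hρ x i j
  have htr : ∀ U, f (Φ U) = ω * f U := fun U => by
    simp only [hf, hΦ]
    rw [plaquetteHolonomy_mulLink z x hij U, map_mul, hω, Matrix.smul_mul, Matrix.one_mul,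
      Matrix.trace_smul, smul_eq_mul]
  have hI : ∫ U, f U ∂π = ω * ∫ U, f U ∂π :=
    calc ∫ U, f U ∂π = ∫ U, f U ∂(Measure.map Φ π) := by rw [hΦm.map_eq]
      _ = ∫ U, f (Φ U) ∂π := integral_map hΦm.measurable.aemeasurable hfm.aestronglyMeasurable
      _ = ∫ U, ω * f U ∂π := integral_congr_ae (ae_of_all _ htr)
      _ = ω * ∫ U, f U ∂π := integral_const_mul ω _
  have h2 : (1 - ω) * ∫ U, f U ∂π = 0 := by rw [sub_mul, one_mul, ← hI, sub_self]
  exact (mul_eq_zero.1 h2).resolve_left (sub_ne_zero.2 hne.symm)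

/-- Real form: `∫ Re tr ρ(U_{x,ij}) ∏ₑ dU_e = 0` (`i ≠ j`, `L ≥ 2`, a central `z` acting by
`ω ≠ 1`; Montvay–Münster (3.305) `∫ dU χ_r(U) = δ_{r,0}` on the torus).
[cite: MontvayMunster1994, §3.4 eq. (3.305), PDF p. 142] -/
theorem integral_re_trace_plaquetteHolonomy_eq_zero [Fact (1 < L)] (hρ : Continuous ρ) {z : G}
    {ω : ℂ} (hω : ρ z = ω • (1 : Matrix (Fin N) (Fin N) ℂ)) (hne : ω ≠ 1) (x : Site d L)
    {i j : Fin d} (hij : i ≠ j) :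
    ∫ U, (ρ (plaquetteHolonomy U x i j)).trace.re
      ∂(Measure.pi fun _ : Edge d L => haarProbability G) = 0 := by
  have hint : Integrable (fun U : GaugeConfig d L G => (ρ (plaquetteHolonomy U x i j)).trace)
      (Measure.pi fun _ : Edge d L => haarProbability G) :=
    Integrable.of_bound (C := (N : ℝ))
      (measurable_trace_plaquetteHolonomy ρ hρ x i j).aestronglyMeasurable
      (ae_of_all _ fun U => norm_trace_le ρ hρ _)
  have h := integral_re hint
  simp only [RCLike.re_to_complex] at h
  rw [h, integral_trace_plaquetteHolonomy_eq_zero ρ hρ hω hne x hij, Complex.zero_re]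

/-- **`⟨S⟩_{Λ,0} = N · #plaquettes`**: at `β = 0` the Wilson state is product Haar measure and every
plaquette character has mean zero (a central `z` acting by `ω ≠ 1`; `L ≥ 2`).
[cite: MontvayMunster1994, §3.2 (3.113), PDF p. 123] -/
theorem wilsonExpectation_wilsonAction_zero [Fact (1 < L)] (hρ : Continuous ρ) {z : G} {ω : ℂ}
    (hω : ρ z = ω • (1 : Matrix (Fin N) (Fin N) ℂ)) (hne : ω ≠ 1) :
    wilsonExpectation ρ 0 (wilsonAction (d := d) (L := L) (G := G) ρ) =
      N * Fintype.card (Plaquette d L) := by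
  rw [wilsonExpectation_eq_integral_div ρ hρ 0]
  simp only [neg_zero, zero_mul, Real.exp_zero, mul_one, integral_const, probReal_univ, smul_eq_mul,
    div_one]
  have hp : ∀ p : Plaquette d L, ∫ U : GaugeConfig d L G,
      ((N : ℝ) - (ρ (plaquetteHolonomy U p.1 p.2.1.1 p.2.1.2)).trace.re)
        ∂(Measure.pi fun _ : Edge d L => haarProbability G) = N := by
    intro p
    rw [integral_sub (integrable_const _) (integrable_re_trace_plaquetteHolonomy ρ hρ _ _ _ _),
      integral_const, probReal_univ, one_smul,
      integral_re_trace_plaquetteHolonomy_eq_zero ρ hρ hω hne p.1 (ne_of_lt p.2.2), sub_zero]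
  have hint : ∀ p : Plaquette d L, Integrable (fun U : GaugeConfig d L G =>
      (N : ℝ) - (ρ (plaquetteHolonomy U p.1 p.2.1.1 p.2.1.2)).trace.re)
        (Measure.pi fun _ : Edge d L => haarProbability G) := fun p =>
    (integrable_const _).sub (integrable_re_trace_plaquetteHolonomy ρ hρ _ _ _ _)
  unfold wilsonAction
  rw [integral_finsetSum _ fun p _ => hint p,
    Finset.sum_congr rfl fun p _ => hp p, Finset.sum_const, Finset.card_univ, nsmul_eq_mul, mul_comm]

end HaarMean

/-! ### The plaquette expectation is non-zero at `β ≠ 0` -/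

section Plaquette

variable [NeZero L]

/-- `Re ω < 1` for `|ω| = 1`, `ω ≠ 1`. [folklore] -/
private theorem re_lt_one_of_norm_eq_one {ω : ℂ} (hω1 : ‖ω‖ = 1) (hne : ω ≠ 1) : ω.re < 1 := by
  have h1 : ω.re ≤ 1 :=
    calc ω.re ≤ ‖ω‖ := Complex.re_le_norm ω
      _ = 1 := hω1
  refine lt_of_le_of_ne h1 fun hre => hne ?_
  have hsq : ω.re * ω.re + ω.im * ω.im = 1 := by
    rw [← Complex.normSq_apply, ← Complex.sq_norm, hω1, one_pow]
  have him : ω.im = 0 := by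
    have : ω.im * ω.im = 0 := by rw [hre] at hsq; linarith
    exact mul_self_eq_zero.1 this
  exact Complex.ext (by simpa using hre) (by simpa using him)

omit [MeasurableSpace G] [BorelSpace G] in
/-- Plaquette costs are non-negative: `Re tr ρ(g) ≤ N`. [folklore] -/
private theorem plaquetteCost_nonneg (hρ : Continuous ρ) (g : G) : 0 ≤ (N : ℝ) - (ρ g).trace.re := by
  have h : |(ρ g).trace.re| ≤ N := by simpa using CompactGroup.abs_re_trace_le_card ρ hρ g
  linarith [(abs_le.1 h).2]

omit [MeasurableSpace G] [BorelSpace G] in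
/-- The Wilson action is not identically zero: the configuration with a single link equal to a
central `z` acting by `ω ≠ 1`, `|ω| = 1`, has `S ≥ N(1 - Re ω) > 0` (`N ≥ 1`, `L ≥ 2`, `d ≥ 2`).
[folklore] -/
private theorem exists_wilsonAction_ne_zero [Fact (1 < L)] [NeZero N] (hρ : Continuous ρ) {z : G}
    {ω : ℂ} (hω : ρ z = ω • (1 : Matrix (Fin N) (Fin N) ℂ)) (hω1 : ‖ω‖ = 1) (hne : ω ≠ 1)
    (x : Site d L) {k l : Fin d} (hkl : k < l) :
    ∃ U : GaugeConfig d L G, wilsonAction ρ U ≠ 0 := by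
  set U₀ : GaugeConfig d L G := fun e => (if e = (x, k) then z else 1) * (1 : GaugeConfig d L G) e
    with hU₀
  refine ⟨U₀, ne_of_gt ?_⟩
  have hre : ω.re < 1 := re_lt_one_of_norm_eq_one hω1 hne
  have hhol : plaquetteHolonomy U₀ x k l = z := by
    rw [hU₀, plaquetteHolonomy_mulLink z x (ne_of_lt hkl),
      show plaquetteHolonomy (1 : GaugeConfig d L G) x k l = 1 by simp [plaquetteHolonomy], mul_one]
  have hcost : (N : ℝ) - (ρ (plaquetteHolonomy U₀ x k l)).trace.re = N * (1 - ω.re) := by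
    rw [hhol, hω, Matrix.trace_smul, Matrix.trace_one, smul_eq_mul, Fintype.card_fin,
      Complex.mul_re, Complex.natCast_re, Complex.natCast_im, mul_zero, sub_zero]
    ring
  have hN : (0 : ℝ) < N := by exact_mod_cast Nat.pos_of_ne_zero (NeZero.ne N)
  unfold wilsonAction
  refine lt_of_lt_of_le ?_ (Finset.single_le_sum
    (f := fun p : Plaquette d L => (N : ℝ) - (ρ (plaquetteHolonomy U₀ p.1 p.2.1.1 p.2.1.2)).trace.re)
    (fun p _ => plaquetteCost_nonneg ρ hρ _) (Finset.mem_univ (x, ⟨(k, l), hkl⟩)))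
  show 0 < (N : ℝ) - (ρ (plaquetteHolonomy U₀ x k l)).trace.re
  rw [hcost]
  exact mul_pos hN (by linarith)

/-- **The plaquette character has positive mean at `β > 0`**: for a compact group `G`, a continuous
`N`-dimensional representation `ρ` (`N ≥ 1`) with a central `z` acting by `ω ≠ 1`, `|ω| = 1`, on
the torus `(ℤ/Lℤ)^d`, `L ≥ 2`, every site `x`, axes `i ≠ j` and every `β > 0`:
`0 < ⟨Re tr ρ(U_{x,ij})⟩_{Λ,β}`.  (Strict decrease of the mean action from `⟨S⟩_0 = N · #plaquettes`
and equality of the plaquette means, `wilsonExpectation_wilsonAction_eq_card_mul`.)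
[cite: MontvayMunster1994, §3.2 (3.113), PDF p. 123] -/
theorem wilsonExpectation_re_trace_plaquette_pos [Fact (1 < L)] [NeZero N] (hρ : Continuous ρ)
    {z : G} {ω : ℂ} (hω : ρ z = ω • (1 : Matrix (Fin N) (Fin N) ℂ)) (hω1 : ‖ω‖ = 1) (hne : ω ≠ 1)
    {β : ℝ} (hβ : 0 < β) (x : Site d L) {i j : Fin d} (hij : i ≠ j) :
    0 < wilsonExpectation ρ β
      (fun U : GaugeConfig d L G => (ρ (plaquetteHolonomy U x i j)).trace.re) := by
  obtain ⟨k, l, hkl⟩ : ∃ k l : Fin d, k < l := by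
    rcases lt_or_gt_of_ne hij with h | h
    · exact ⟨i, j, h⟩
    · exact ⟨j, i, h⟩
  have hS := exists_wilsonAction_ne_zero ρ hρ hω hω1 hne x hkl
  have hlt := wilsonExpectation_wilsonAction_strictAnti ρ hρ hS hβ
  simp only at hlt
  rw [wilsonExpectation_wilsonAction_zero ρ hρ hω hne,
    wilsonExpectation_wilsonAction_eq_card_mul ρ hρ β x hij] at hlt
  have hcard : (0 : ℝ) < Fintype.card (Plaquette d L) := by
    exact_mod_cast Fintype.card_pos_iff.2 (⟨(x, ⟨(k, l), hkl⟩)⟩ : Nonempty (Plaquette d L))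
  have hc : wilsonExpectation ρ β (fun U : GaugeConfig d L G =>
      (N : ℝ) - (ρ (plaquetteHolonomy U x i j)).trace.re) < N := by
    rw [mul_comm (N : ℝ)] at hlt
    exact lt_of_mul_lt_mul_left hlt hcard.le
  haveI := isProbabilityMeasure_wilsonMeasure (d := d) (L := L) (G := G) ρ hρ β
  have hX := integrable_re_trace_plaquetteHolonomy ρ hρ x i j (wilsonMeasure ρ β)
  have hsub : wilsonExpectation ρ β (fun U : GaugeConfig d L G =>
      (N : ℝ) - (ρ (plaquetteHolonomy U x i j)).trace.re) =
      N - wilsonExpectation ρ β (fun U : GaugeConfig d L G => (ρ (plaquetteHolonomy U x i j)).trace.re) := by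
    simp only [wilsonExpectation]
    rw [integral_sub (integrable_const _) hX, integral_const, probReal_univ, one_smul]
  rw [hsub] at hc
  linarith

/-- **… and negative mean at `β < 0`**: `⟨Re tr ρ(U_{x,ij})⟩_{Λ,β} < 0` for `β < 0` (same
hypotheses). [cite: MontvayMunster1994, §3.2 (3.113), PDF p. 123] -/
theorem wilsonExpectation_re_trace_plaquette_neg [Fact (1 < L)] [NeZero N] (hρ : Continuous ρ)
    {z : G} {ω : ℂ} (hω : ρ z = ω • (1 : Matrix (Fin N) (Fin N) ℂ)) (hω1 : ‖ω‖ = 1) (hne : ω ≠ 1)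
    {β : ℝ} (hβ : β < 0) (x : Site d L) {i j : Fin d} (hij : i ≠ j) :
    wilsonExpectation ρ β
      (fun U : GaugeConfig d L G => (ρ (plaquetteHolonomy U x i j)).trace.re) < 0 := by
  obtain ⟨k, l, hkl⟩ : ∃ k l : Fin d, k < l := by
    rcases lt_or_gt_of_ne hij with h | h
    · exact ⟨i, j, h⟩
    · exact ⟨j, i, h⟩
  have hS := exists_wilsonAction_ne_zero ρ hρ hω hω1 hne x hkl
  have hlt := wilsonExpectation_wilsonAction_strictAnti ρ hρ hS hβ
  simp only at hlt
  rw [wilsonExpectation_wilsonAction_zero ρ hρ hω hne,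
    wilsonExpectation_wilsonAction_eq_card_mul ρ hρ β x hij] at hlt
  have hcard : (0 : ℝ) < Fintype.card (Plaquette d L) := by
    exact_mod_cast Fintype.card_pos_iff.2 (⟨(x, ⟨(k, l), hkl⟩)⟩ : Nonempty (Plaquette d L))
  have hc : (N : ℝ) < wilsonExpectation ρ β (fun U : GaugeConfig d L G =>
      (N : ℝ) - (ρ (plaquetteHolonomy U x i j)).trace.re) := by
    rw [mul_comm (N : ℝ)] at hlt
    exact lt_of_mul_lt_mul_left hlt hcard.le
  haveI := isProbabilityMeasure_wilsonMeasure (d := d) (L := L) (G := G) ρ hρ β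
  have hX := integrable_re_trace_plaquetteHolonomy ρ hρ x i j (wilsonMeasure ρ β)
  have hsub : wilsonExpectation ρ β (fun U : GaugeConfig d L G =>
      (N : ℝ) - (ρ (plaquetteHolonomy U x i j)).trace.re) =
      N - wilsonExpectation ρ β (fun U : GaugeConfig d L G => (ρ (plaquetteHolonomy U x i j)).trace.re) := by
    simp only [wilsonExpectation]
    rw [integral_sub (integrable_const _) hX, integral_const, probReal_univ, one_smul]
  rw [hsub] at hc
  linarith

omit [TopologicalSpace G] [IsTopologicalGroup G] [CompactSpace G] [MeasurableSpace G] [BorelSpace G]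
  [NeZero L] in
/-- The `1 × 1` Wilson loop is the normalised plaquette trace `(1/N) Re tr ρ(U_{x,ij})`. [folklore] -/
private theorem wilsonLoop_one_one_eq (x : Site d L) (i j : Fin d) :
    wilsonLoop ρ x i j 1 1 = fun U : GaugeConfig d L G =>
      (N : ℝ)⁻¹ * (ρ (plaquetteHolonomy U x i j)).trace.re := by
  funext U
  simp [wilsonLoop, rectangleHolonomy, lineHolonomy, plaquetteHolonomy, Site.shift]

/-- **`⟨W_{1×1}⟩_{Λ,β} > 0` for `β > 0`** (normalised `1 × 1` Wilson loop in the `(i, j)` plane at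
`x`; hypotheses as in `wilsonExpectation_re_trace_plaquette_pos`).
[cite: MontvayMunster1994, §3.2 (3.113), PDF p. 123] -/
theorem wilsonExpectation_wilsonLoop_one_one_pos [Fact (1 < L)] [NeZero N] (hρ : Continuous ρ)
    {z : G} {ω : ℂ} (hω : ρ z = ω • (1 : Matrix (Fin N) (Fin N) ℂ)) (hω1 : ‖ω‖ = 1) (hne : ω ≠ 1)
    {β : ℝ} (hβ : 0 < β) (x : Site d L) {i j : Fin d} (hij : i ≠ j) :
    0 < wilsonExpectation ρ β (wilsonLoop ρ x i j 1 1) := by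
  rw [wilsonLoop_one_one_eq]
  simp only [wilsonExpectation]
  rw [integral_const_mul]
  have hN : (0 : ℝ) < N := by exact_mod_cast Nat.pos_of_ne_zero (NeZero.ne N)
  exact mul_pos (inv_pos.2 hN) (wilsonExpectation_re_trace_plaquette_pos ρ hρ hω hω1 hne hβ x hij)

/-- **`⟨W_{1×1}⟩_{Λ,β} < 0` for `β < 0`.** [cite: MontvayMunster1994, §3.2 (3.113), PDF p. 123] -/
theorem wilsonExpectation_wilsonLoop_one_one_neg [Fact (1 < L)] [NeZero N] (hρ : Continuous ρ)
    {z : G} {ω : ℂ} (hω : ρ z = ω • (1 : Matrix (Fin N) (Fin N) ℂ)) (hω1 : ‖ω‖ = 1) (hne : ω ≠ 1)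
    {β : ℝ} (hβ : β < 0) (x : Site d L) {i j : Fin d} (hij : i ≠ j) :
    wilsonExpectation ρ β (wilsonLoop ρ x i j 1 1) < 0 := by
  rw [wilsonLoop_one_one_eq]
  simp only [wilsonExpectation]
  rw [integral_const_mul]
  have hN : (0 : ℝ) < N := by exact_mod_cast Nat.pos_of_ne_zero (NeZero.ne N)
  exact mul_neg_of_pos_of_neg (inv_pos.2 hN)
    (wilsonExpectation_re_trace_plaquette_neg ρ hρ hω hω1 hne hβ x hij)

end Plaquette

end Literature.MathematicalPhysics.QuantumFieldTheory

end
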